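import Summits.BirchSwinnertonDyer.BirchSwinnertonDyer.Theorems.KolyvaginRankRigidityAtTwoTransverseEigenAtTwo
import Summits.BirchSwinnertonDyer.BirchSwinnertonDyer.Theorems.KolyvaginRankRigidityAtTwoSignedRefillSupplyAtTwo
import Summits.BirchSwinnertonDyer.BirchSwinnertonDyer.Theorems.KolyvaginRankRigidityAtTwoRegularRefillSign
import HarnessLib

/-!
# Crux U1 `KolyvaginBoundedDefectAtTwo` (stmt-BirchSwinnertonDyer-28083), LINE 17 `kolyvagin_swap` —
# SC · SHAPE CUT AT 2 (pen bsd-idea-1 v8.1/v8.2, `line17/SWalphaSplit.lean` def l.249, stub `stub_shapeCutAtTwo` l.291; `kolyvagin_swap_v82.lean` l.1135;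
# one of the three typed M-stubs {ES, SC, SRF} from which SWα⁗ is derived in the kernel) — PROVED, `gC a = 3a + 2`

Width seat `bsd-line-krr2-p2` g18 (ONE READER on LINE 17); `--supports stmt-BirchSwinnertonDyer-28083` (helper). HONEST FRAMING: SC is a typed
sub-target of the pen's (unregistered) v8.1 split of SWα⁗; nothing here proves ES, SWα⁗, U1, a rung or BSD. BSD is NOT proved.

## Statement
`shapeCutAtTwo` = the pen's `ShapeCutAtTwo` BYTE-FOR-BYTE with its concluding `OppShape W K ι τ M (e * ℓ) u (gC a) t` UNFOLDED (the v8.x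
definitions are not an importable module; with `OppShape` in scope the stub closes by `exact shapeCutAtTwo`): if the `(−u)`-part of
`H_{𝓕(e)}(K, E[2^M])` has shape `Sh(t+1, a)` witnessed by `g₀, …, g_t`, and `ℓ ∤ e` is a Kolyvagin prime (`eℓ` square-free Kolyvagin, margin one)
with a place `v ∣ ℓ` at which `g₁ … g_t` are locally trivial and `2^(M−a−1) loc_v g₀ ≠ 0`, then the `(−u)`-part of `H_{𝓕(eℓ)}` has shape
`Sh(t, 3a + 2)` witnessed by `g₁ … g_t`.

## Proof (the CUT half of the signed refill law — all pieces in the tree)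
(1) the kept classes survive into `H_{𝓕(eℓ)}` (locally trivial at `v`) and stay nearly free (extend a relation by `b₀ = 0`); (2) THE CUT LAW =
g14's `RegularRefill.nsmul_add_smul_eq_zero_of_mem_lagrangian` (`…RegularRefillSign`): its hypothesis `2^(a+1) · Kum_v^{(−u)} ⊆ X` holds because
`Kum_v^{(−u)}` has `≤ 2^(M+1)` elements (`kummer_eigen_at_two_of_index`) and contains `loc g₀ ∈ X` of order `≥ 2^(M−a)` (counting,
`forall_exists_zsmul_eq_of_natCard_le_of_nsmul_eq_zero`); hence every exact `(−u)`-class `y ∈ H_{𝓕(eℓ)}` has `2^(a+2) loc_v y = 0`; (3)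
`w = 2^(a+2) y` is locally trivial at `v`, so `w ∈ H_{𝓕(e)}` (`H¹_{𝓕(eℓ)[v ↦ Kum]} = H_{𝓕(e)}`, g15) and `2^a w ≡ Σ bᵢ gᵢ` modulo phantoms by
the old shape; localising at `v` (Φ-KILL) gives `b₀ loc g₀ = 0`, so `2^(M−a) ∣ b₀` and `2^a b₀ g₀ = 0`: `2^(3a+2) y ≡ Σ_{i ≥ 1} 2^a bᵢ gᵢ`.
References (locators only; no cited FACT is declared): [cite: MazurRubin2004, §4.1 Prop. 4.1.5, Lemma 4.1.7, Cor. 4.1.9]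
[cite: Howard2004HeegnerKolyvagin, §1.5–1.6] [cite: Kolyvagin1991StructureSha, Prop. 8] [cite: Jetchev2008, §3.4.1].
Design: no definitions; `K : Type`; axioms `propext`, `Classical.choice`, `Quot.sound`.
-/

set_option autoImplicit false
-- the Theorems namespace of this sub repeats the summit name by design (D-0017 nested layout)
set_option linter.dupNamespace false

noncomputable section

open scoped Classical
open Function NumberField IsDedekindDomain WeierstrassCurve Field Finset
open Literature.NumberTheory.EllipticCurves Literature.NumberTheory.EllipticCurves.Jetchev2008
open Literature.NumberTheory.EllipticCurves.KolyvaginPairing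
open Literature.NumberTheory.GaloisRepresentations Literature.NumberTheory.GaloisCohomology
open Literature.NumberTheory.GaloisRepresentations.DiscreteGaloisModule (transverseSubgroup SelmerStructure)
open Literature.NumberTheory.Automorphic Literature.NumberTheory
open Summit.BirchSwinnertonDyer.Rank1Residual
open Summit.BirchSwinnertonDyer.Rank1Residual.JET.SelmerVocabulary
open Summit.BirchSwinnertonDyer.Rank1Residual.JET.GlobalDuality (smul_place_eq_self_of_natCast_mem)
open Summit.BirchSwinnertonDyer.BirchSwinnertonDyer.Theorems.KolyvaginLowerBoundAtTwo (exists_weilDatum_liftAut_two_pow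
  weil_equivariant_of_isLiftOfAut)

namespace Summit.BirchSwinnertonDyer.BirchSwinnertonDyer.Theorems.KolyvaginAtTwo.RegularWalk

/-- `2^(c+a) • w − Σᵢ (2^a bᵢ) • gᵢ = 2^a • (2^c • w − Σᵢ bᵢ • gᵢ)` (generic spelling, safe for `H¹(K, E[2^M])`). [folklore] -/
theorem zsmul_sub_sum_zsmul_eq {G : Type*} [AddCommGroup G] {m : ℕ} (c a : ℕ) (w : G) (b : Fin m → ℤ) (g : Fin m → G) :
    (2 : ℤ) ^ (c + a) • w - ∑ i, ((2 : ℤ) ^ a * b i) • g i = (2 : ℤ) ^ a • ((2 : ℤ) ^ c • w - ∑ i, b i • g i) := by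
  rw [smul_sub, smul_smul, ← pow_add, add_comm, Finset.smul_sum]
  congr 1
  exact Finset.sum_congr rfl fun i _ ↦ by rw [smul_smul]

set_option maxHeartbeats 400000 in
/-- **SC `ShapeCutAtTwo` (pen v8.1, VERBATIM with the concluding `OppShape` unfolded), `gC a = 3a + 2`.** See the module docstring.
[cite: MazurRubin2004, §4.1 Prop. 4.1.5, Lemma 4.1.7, Cor. 4.1.9] [cite: Howard2004HeegnerKolyvagin, §1.5–1.6] -/
theorem shapeCutAtTwo :
    ∀ (W : WeierstrassCurve ℚ) [W.IsElliptic] [W.IsGloballyMinimal], ¬ W.HasCM → (Literature.NumberTheory.EllipticCurves.Rank1Residual.GoodOrd W 2 ∨ Literature.NumberTheory.EllipticCurves.Rank1Residual.Mult W 2) → (∀ m : ℕ, W.HasSurjectiveModNGaloisRep (2 ^ m : ℕ)) → ∀ (K : Type) [Field K] [NumberField K], Literature.NumberTheory.EllipticCurves.IsImaginaryQuadratic K → ∀ [NeZero (W.conductorNorm ℤ)], Literature.NumberTheory.EllipticCurves.SatisfiesHeegnerHypothesis (W.conductorNorm ℤ) K → Odd (NumberField.discr K) → NumberField.discr K ≠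 -3 → AddSubgroup.torsionBy (W.baseChange K).toAffine.Point (2 : ℤ) = ⊥ → Literature.NumberTheory.EllipticCurves.SatisfiesHeegnerHypothesis 2 K → ∀ (Dt : Literature.NumberTheory.EllipticCurves.ModularForms.ModularParametrizationData W (W.conductorNorm ℤ)) (β : ℤ) (ι : K →+* ℂ) [∀ k : ℕ, NumberField (ringClassField K ι k)], (4 * (W.conductorNorm ℤ : ℤ)) ∣ β ^ 2 - NumberField.discr K →
    ∀ (τ : K ≃ₐ[ℚ] K), τ ≠ 1 → ∀ (u : ℤ), (u = 1 ∨ u = -1) →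
    ∃ gC : ℕ → ℕ, ∀ (M e ℓ a t : ℕ) (g : Fin (t + 1) → galH1Torsion (W.baseChange K) ((2 ^ M : ℕ) : ℤ)),
      Literature.NumberTheory.EllipticCurves.KolyvaginDescent.KolSupp (Literature.NumberTheory.EllipticCurves.Zhang2014.IsKolyvaginPrime (W.conductorNorm ℤ) W K 2) (e * ℓ) →
      ℓ.Prime → ¬ ℓ ∣ e → 1 ≤ M → (((M + 1 : ℕ) : ℕ) : ℕ∞) ≤ Literature.NumberTheory.EllipticCurves.Zhang2014.levelIndex W 2 (e * ℓ) →
      (∀ i, g i ∈ Jetchev2008.modifiedSelmerGroup W K ι ((2 ^ M : ℕ) : ℤ) e) →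
      (∀ i, conjAct W τ ((2 ^ M : ℕ) : ℤ) (g i) = (-u) • g i) →
      (∀ b : Fin (t + 1) → ℤ, (∀ σ ∈ torsionFixing (W.baseChange K) ((2 ^ (M + 1) : ℕ) : ℤ),
          h1Eval (W.baseChange K) ((2 ^ M : ℕ) : ℤ) (∑ i, b i • g i) σ = 0) → ∀ i, (2 : ℤ) ^ (M - a) ∣ b i) →
      (∀ y : galH1Torsion (W.baseChange K) ((2 ^ M : ℕ) : ℤ), y ∈ Jetchev2008.modifiedSelmerGroup W K ι ((2 ^ M : ℕ) : ℤ) e →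
        conjAct W τ ((2 ^ M : ℕ) : ℤ) y = (-u) • y →
        ∃ b : Fin (t + 1) → ℤ, ∀ σ ∈ torsionFixing (W.baseChange K) ((2 ^ (M + 1) : ℕ) : ℤ),
          h1Eval (W.baseChange K) ((2 ^ M : ℕ) : ℤ) (((2 : ℤ) ^ a) • y - ∑ i, b i • g i) σ = 0) →
      (∃ v : IsDedekindDomain.HeightOneSpectrum (NumberField.RingOfIntegers K), (ℓ : NumberField.RingOfIntegers K) ∈ v.asIdeal ∧
          (∀ i : Fin t, g i.succ ∈ (W.baseChange K).torsionLocalKer (v.adicCompletion K) ((2 ^ M : ℕ) : ℤ)) ∧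
          ((2 ^ (M - a - 1) : ℕ) : ℤ) • g 0 ∉ (W.baseChange K).torsionLocalKer (v.adicCompletion K) ((2 ^ M : ℕ) : ℤ)) →
      ∃ (g' : Fin t → galH1Torsion (W.baseChange K) ((2 ^ M : ℕ) : ℤ)),
        (∀ i, g' i ∈ Jetchev2008.modifiedSelmerGroup W K ι ((2 ^ M : ℕ) : ℤ) (e * ℓ)) ∧
        (∀ i, conjAct W τ ((2 ^ M : ℕ) : ℤ) (g' i) = (-u) • g' i) ∧
        (∀ b : Fin t → ℤ, (∀ σ ∈ torsionFixing (W.baseChange K) ((2 ^ (M + 1) : ℕ) : ℤ),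
            h1Eval (W.baseChange K) ((2 ^ M : ℕ) : ℤ) (∑ i, b i • g' i) σ = 0) → ∀ i, (2 : ℤ) ^ (M - gC a) ∣ b i) ∧
        (∀ y : galH1Torsion (W.baseChange K) ((2 ^ M : ℕ) : ℤ), y ∈ Jetchev2008.modifiedSelmerGroup W K ι ((2 ^ M : ℕ) : ℤ) (e * ℓ) →
          conjAct W τ ((2 ^ M : ℕ) : ℤ) y = (-u) • y →
          ∃ b : Fin t → ℤ, ∀ σ ∈ torsionFixing (W.baseChange K) ((2 ^ (M + 1) : ℕ) : ℤ),
            h1Eval (W.baseChange K) ((2 ^ M : ℕ) : ℤ) (((2 : ℤ) ^ (gC a)) • y - ∑ i, b i • g' i) σ = 0) := by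
  intro W _ _ hCM hred hsur K _ _ hK _ hH hodd hd3 htors hH2 Dt β ι _ hβ τ hτ1 u hu
  classical
  refine ⟨fun a ↦ 3 * a + 2, fun M e' q a t g hKol hq hqe hM hidx hgS hgτ hfree hspan hplace ↦ ?_⟩
  dsimp only
  obtain ⟨v, hv, hkept, hcut0⟩ := hplace
  haveI : NeZero (2 ^ M) := ⟨pow_ne_zero M two_ne_zero⟩
  haveI hEK : (W.baseChange K).IsElliptic := by rw [baseChange]; infer_instance
  have hle : torsionFixing (W.baseChange K) ((2 ^ (M + 1) : ℕ) : ℤ) ≤ torsionFixing (W.baseChange K) ((2 ^ M : ℕ) : ℤ) :=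
    KolyvaginLowerBoundAtTwo.torsionFixing_le_of_dvd _ (by exact_mod_cast Nat.pow_dvd_pow 2 (Nat.le_succ M))
  have h2M : ∀ z : galH1Torsion (W.baseChange K) ((2 ^ M : ℕ) : ℤ), ((2 ^ M : ℕ) : ℤ) • z = 0 := fun z ↦
    zsmul_galH1Torsion_eq_zero (W.baseChange K) _ z
  -- the frame data at level `2^M`
  have hs : (-u = 1 ∨ -u = -1) := by rcases hu with rfl | rfl <;> norm_num
  haveI : Finite (geomTorsion (W.baseChange K) ((2 ^ M : ℕ) : ℤ)) := finite_geomTorsion_of_neZero (W.baseChange K) (2 ^ M)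
  have hne4 : NumberField.discr K ≠ -4 := fun h ↦ by rw [h] at hodd; exact absurd hodd (by decide)
  have hD : NumberField.discr K < -4 := X11b.KolyvaginAssembly.discr_lt_neg_four hK ⟨hd3, hne4⟩
  obtain ⟨inv, hperf, hvan, -, hSC, hconj⟩ := InputsPoitouTateSelmer.poitouTate_selmerStructure_duality_conj_holds K (2 ^ M)
  obtain ⟨ew, hμ, hadd₁, hadd₂, hgal, halt, hnondeg, hτe⟩ := exists_weilDatum_liftAut_two_pow (K := K) W τ M
  -- the conductor `c = e·q` (`q` the new prime) and the place `v ∣ q` of the hypothesis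
  have hn0 : e' * q ≠ 0 := hKol.1.ne_zero
  have hc : Squarefree (e' * q) := hKol.1
  have hqmem : q ∈ (e' * q).primeFactors := Nat.mem_primeFactors.mpr ⟨hq, dvd_mul_left q e', hn0⟩
  have hKolq : Zhang2014.IsKolyvaginPrime (W.conductorNorm ℤ) W K 2 q := hKol.2 q hqmem
  have hkM : ∀ ℓ ∈ (e' * q).primeFactors, M + 1 ≤ Zhang2014.kolyvaginIndex W 2 ℓ :=
    Zhang2014.natCast_le_levelIndex_iff.mp hidx
  have hkol : ∀ ℓ ∈ (e' * q).primeFactors, Zhang2014.IsKolyvaginPrime (W.conductorNorm ℤ) W K 2 ℓ := fun ℓ hℓ ↦ hKol.2 ℓ hℓ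
  have hfix : τ • v = v := smul_place_eq_self_of_natCast_mem τ hq.ne_zero hKolq.2.2.2.2.1 v hv
  have hτe' : ∀ S T, liftAutPlace τ hfix (ew S T) =
      ew ((isLiftOfAut_liftAutPlace τ hfix).torsionMap W ((2 ^ M : ℕ) : ℤ) S)
        ((isLiftOfAut_liftAutPlace τ hfix).torsionMap W ((2 ^ M : ℕ) : ℤ) T) :=
    weil_equivariant_of_isLiftOfAut W ((2 ^ M : ℕ) : ℤ) (isLiftOfAut_liftAutPlace τ hfix) (isLiftOfAut_liftAut τ)
      ew hgal hτe
  -- the transverse family of `e·q` by its defining formula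
  let 𝒯' : SelmerStructure ((W.baseChange K).torsionGaloisModule ((2 ^ M : ℕ) : ℤ)) := fun w ↦ match w with
    | Sum.inl _ => ⊤
    | Sum.inr w => ⨅ ℓ' ∈ (e' * q).primeFactors.filter (fun ℓ' : ℕ ↦ ((ℓ' : ℕ) : 𝓞 K) ∈ w.asIdeal),
        ⨅ (w' : HeightOneSpectrum (𝓞 (ringClassField K ι ℓ'))) (_ : w'.asIdeal.LiesOver w.asIdeal),
          letI := (adicCompletionOfLiesOver K (ringClassField K ι ℓ') w w').toAlgebra
          transverseSubgroup (GaloisRep.toLocal w ((W.baseChange K).torsionGaloisModule ((2 ^ M : ℕ) : ℤ)))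
            (w'.adicCompletion (ringClassField K ι ℓ'))
  have h𝒯' : ∀ w : HeightOneSpectrum (𝓞 K), 𝒯' (Sum.inr w) =
      ⨅ ℓ' ∈ (e' * q).primeFactors.filter (fun ℓ' : ℕ ↦ ((ℓ' : ℕ) : 𝓞 K) ∈ w.asIdeal),
        ⨅ (w' : HeightOneSpectrum (𝓞 (ringClassField K ι ℓ'))) (_ : w'.asIdeal.LiesOver w.asIdeal),
          letI := (adicCompletionOfLiesOver K (ringClassField K ι ℓ') w w').toAlgebra
          transverseSubgroup (GaloisRep.toLocal w ((W.baseChange K).torsionGaloisModule ((2 ^ M : ℕ) : ℤ)))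
            (w'.adicCompletion (ringClassField K ι ℓ')) := fun w ↦ rfl
  set 𝓛 := selmerF W ((2 ^ M : ℕ) : ℤ) 𝒯' (placesDividing K (e' * q)) with h𝓛def
  -- the two vertices in the walk's currency
  have hS'eq : 𝓛.selmerGroup = modifiedSelmerGroup W K ι ((2 ^ M : ℕ) : ℤ) (e' * q) :=
    selmerGroup_selmerF_eq_modifiedSelmerGroup_of_dvd W ι _ hc dvd_rfl 𝒯' h𝒯'
  have hSeq : SelmerStructure.selmerGroup (Function.update 𝓛 (Sum.inr v : Place K)
        ((W.baseChange K).kummerSelmerStructure ((2 ^ M : ℕ) : ℤ) (Sum.inr v : Place K)) :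
        SelmerStructure ((W.baseChange K).torsionGaloisModule ((2 ^ M : ℕ) : ℤ))) =
      modifiedSelmerGroup W K ι ((2 ^ M : ℕ) : ℤ) e' :=
    selmerGroup_update_kummer_eq_modifiedSelmerGroup W ι _ hc hq hKolq.2.2.2.2.1 hv 𝒯' h𝒯'
  -- `loc_v` in the `galH1Torsion` spelling
  let loc : galH1Torsion (W.baseChange K) ((2 ^ M : ℕ) : ℤ) →+
      galoisCohomology (((W.baseChange K).torsionGaloisModule ((2 ^ M : ℕ) : ℤ)).toLocal (Sum.inr v : Place K)) 1 :=
    galoisCohomology.localization ((W.baseChange K).torsionGaloisModule ((2 ^ M : ℕ) : ℤ)) (Sum.inr v : Place K) 1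
  -- dictionary at `v`
  have h𝓛v : 𝓛 (Sum.inr v) = 𝒯' (Sum.inr v) := by
    rw [h𝓛def, selmerF_inr, if_pos (RegularRefill.mem_placesDividing_of_mem_primeFactors hc hqmem v hv)]
  have hS' : 𝓛.selmerGroup = SelmerStructure.selmerGroup (Function.update 𝓛 (Sum.inr v : Place K) ⊤ :
      SelmerStructure ((W.baseChange K).torsionGaloisModule ((2 ^ M : ℕ) : ℤ))) ⊓
      (𝒯' (Sum.inr v)).comap (galoisCohomology.localization ((W.baseChange K).torsionGaloisModule ((2 ^ M : ℕ) : ℤ)) (Sum.inr v : Place K) 1) := by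
    have h := RegularRefill.selmerGroup_update_eq_inf_comap W M 𝓛 v (𝒯' (Sum.inr v))
    have hupd : Function.update 𝓛 (Sum.inr v : Place K) (𝒯' (Sum.inr v)) = 𝓛 := by rw [← h𝓛v, Function.update_eq_self]
    rw [hupd] at h
    exact h
  have hSKum := RegularRefill.selmerGroup_update_eq_inf_comap W M 𝓛 v
    ((W.baseChange K).kummerSelmerStructure ((2 ^ M : ℕ) : ℤ) (Sum.inr v : Place K))
  have hloceig : ∀ {z : galH1Torsion (W.baseChange K) ((2 ^ M : ℕ) : ℤ)}, conjAct W τ ((2 ^ M : ℕ) : ℤ) z = (-u) • z →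
      conjActPlace W τ ((2 ^ M : ℕ) : ℤ) hfix (loc z) = (-u) • loc z := fun {z} hz ↦ by
    have e3 : conjActPlace W τ ((2 ^ M : ℕ) : ℤ) hfix (loc z) = loc (conjAct W τ ((2 ^ M : ℕ) : ℤ) z) :=
      conjActPlace_localization W τ _ hfix z
    have e2 : loc ((-u) • z) = (-u) • loc z := map_zsmul _ _ _
    rw [e3, hz, e2]
  -- the old vertex `H_{𝓕(e)} = Rel ⊓ loc⁻¹ Kum`: frame classes are in `Rel` with Kummer localisations
  have hgE : ∀ i, g i ∈ SelmerStructure.selmerGroup (Function.update 𝓛 (Sum.inr v : Place K)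
      ((W.baseChange K).kummerSelmerStructure ((2 ^ M : ℕ) : ℤ) (Sum.inr v : Place K)) :
      SelmerStructure ((W.baseChange K).torsionGaloisModule ((2 ^ M : ℕ) : ℤ))) := fun i ↦ by rw [hSeq]; exact hgS i
  have hgRel : ∀ i, g i ∈ SelmerStructure.selmerGroup (Function.update 𝓛 (Sum.inr v : Place K) ⊤ :
      SelmerStructure ((W.baseChange K).torsionGaloisModule ((2 ^ M : ℕ) : ℤ))) := fun i ↦ by
    have h := hgE i; rw [hSKum] at h; exact (AddSubgroup.mem_inf.mp h).1
  have hgKum : ∀ i, loc (g i) ∈ (W.baseChange K).kummerSelmerStructure ((2 ^ M : ℕ) : ℤ) (Sum.inr v : Place K) := fun i ↦ by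
    have h := hgE i; rw [hSKum] at h; exact AddSubgroup.mem_comap.mp (AddSubgroup.mem_inf.mp h).2
  have hg0X : loc (g 0) ∈ (SelmerStructure.selmerGroup (Function.update 𝓛 (Sum.inr v : Place K) ⊤ :
      SelmerStructure ((W.baseChange K).torsionGaloisModule ((2 ^ M : ℕ) : ℤ)))).map
      (galoisCohomology.localization ((W.baseChange K).torsionGaloisModule ((2 ^ M : ℕ) : ℤ)) (Sum.inr v : Place K) 1) :=
    AddSubgroup.mem_map.mpr ⟨g 0, hgRel 0, rfl⟩
  -- kept classes: `loc (g i.succ) = 0`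
  have hkept0 : ∀ i : Fin t, loc (g i.succ) = 0 := fun i ↦
    (KolyvaginLowerBoundAtTwo.mem_torsionLocalKer_two_pow_iff W M v _).mp (hkept i)
  -- the cut: `2^(M-a-1) loc g₀ ≠ 0`
  have hcut0' : (2 : ℤ) ^ (M - (a + 1)) • loc (g 0) ≠ 0 := by
    intro h0
    apply hcut0
    refine (KolyvaginLowerBoundAtTwo.mem_torsionLocalKer_two_pow_iff W M v _).mpr ?_
    have e1 : loc (((2 ^ (M - a - 1) : ℕ) : ℤ) • g 0) = ((2 ^ (M - a - 1) : ℕ) : ℤ) • loc (g 0) := map_zsmul _ _ _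
    change loc (((2 ^ (M - a - 1) : ℕ) : ℤ) • g 0) = 0
    rw [e1, show ((2 ^ (M - a - 1) : ℕ) : ℤ) = (2 : ℤ) ^ (M - (a + 1)) by rw [Nat.cast_pow, Nat.cast_ofNat, Nat.sub_sub]]
    exact h0
  have h2Mloc : ∀ z : galoisCohomology ((((W.baseChange K).torsionGaloisModule ((2 ^ M : ℕ) : ℤ))).toLocal (Sum.inr v : Place K)) 1,
      (2 : ℤ) ^ M • z = 0 := fun z ↦ by
    have h := X11b.KummerPT.nsmul_galoisCohomology_toLocal_eq_zero (W.baseChange K) (2 ^ M) (Sum.inr v) z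
    rw [show ((2 : ℤ) ^ M) = ((2 ^ M : ℕ) : ℤ) by rw [Nat.cast_pow, Nat.cast_ofNat], natCast_zsmul]; exact h
  -- (2) the CUT hypothesis of the sign lemma: `2^(a+1) · Kum_v^{(-u)} ⊆ X` by counting
  haveI : Finite (galoisCohomology ((((W.baseChange K).torsionGaloisModule ((2 ^ M : ℕ) : ℤ))).toLocal
      (Sum.inr v : Place K)) 1) := finite_galoisCohomology_one_toLocal _ v
  obtain ⟨hcount, -⟩ := KolyvaginLowerBoundAtTwo.kummer_eigen_at_two_of_index W K hK hM hKolq (hkM q hqmem) v hv hτ1 hfix hs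
  set G : AddSubgroup (galoisCohomology ((((W.baseChange K).torsionGaloisModule ((2 ^ M : ℕ) : ℤ))).toLocal (Sum.inr v : Place K)) 1) :=
    (W.baseChange K).kummerSelmerStructure ((2 ^ M : ℕ) : ℤ) (Sum.inr v : Place K) ⊓
      (conjActPlace W τ ((2 ^ M : ℕ) : ℤ) hfix - (-u) • AddMonoidHom.id _).ker with hGdef
  have hmemG : ∀ {z}, z ∈ G ↔ z ∈ (W.baseChange K).kummerSelmerStructure ((2 ^ M : ℕ) : ℤ) (Sum.inr v : Place K) ∧
      conjActPlace W τ ((2 ^ M : ℕ) : ℤ) hfix z = (-u) • z := fun {z} ↦ by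
    rw [hGdef, AddSubgroup.mem_inf, AddMonoidHom.mem_ker, AddMonoidHom.sub_apply, AddMonoidHom.smul_apply,
      AddMonoidHom.id_apply, sub_eq_zero]
  obtain ⟨m, -, hm⟩ := (Nat.dvd_prime_pow Nat.prime_two).mp (addOrderOf_dvd_of_nsmul_eq_zero
    (X11b.KummerPT.nsmul_galoisCohomology_toLocal_eq_zero (W.baseChange K) (2 ^ M) (Sum.inr v) (loc (g 0))))
  have hmc : M - (a + 1) + 1 ≤ m := by
    have h := RegularRefill.two_pow_dvd_of_zsmul_eq_zero_of_ne_zero (h2Mloc (loc (g 0))) hcut0' (b := (2 : ℤ) ^ m)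
      (by rw [show ((2 : ℤ) ^ m) = ((2 ^ m : ℕ) : ℤ) by rw [Nat.cast_pow, Nat.cast_ofNat], natCast_zsmul, ← hm];
          exact addOrderOf_nsmul_eq_zero _)
    have h' : 2 ^ (M - (a + 1) + 1) ∣ 2 ^ m := by exact_mod_cast h
    exact (Nat.pow_dvd_pow_iff_le_right one_lt_two).mp h'
  have hcardG : Nat.card G ≤ 2 ^ (m + (a + 1)) := hcount.trans (Nat.pow_le_pow_right (by norm_num) (by omega))
  have hcutX : ∀ f ∈ (W.baseChange K).kummerSelmerStructure ((2 ^ M : ℕ) : ℤ) (Sum.inr v : Place K),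
      conjActPlace W τ ((2 ^ M : ℕ) : ℤ) hfix f = (-u) • f →
      (2 ^ (a + 1)) • f ∈ (SelmerStructure.selmerGroup (Function.update 𝓛 (Sum.inr v : Place K) ⊤ :
        SelmerStructure ((W.baseChange K).torsionGaloisModule ((2 ^ M : ℕ) : ℤ)))).map
        (galoisCohomology.localization ((W.baseChange K).torsionGaloisModule ((2 ^ M : ℕ) : ℤ)) (Sum.inr v : Place K) 1) := by
    intro f hf hfe
    obtain ⟨r, hr⟩ := RegularRefill.forall_exists_zsmul_eq_of_natCard_le_of_nsmul_eq_zero G M m (a + 1)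
      (fun z _ ↦ X11b.KummerPT.nsmul_galoisCohomology_toLocal_eq_zero (W.baseChange K) (2 ^ M) (Sum.inr v) z)
      (hmemG.mpr ⟨hgKum 0, hloceig (hgτ 0)⟩) hm hcardG f (hmemG.mpr ⟨hf, hfe⟩)
    rw [← natCast_zsmul, hr]
    exact AddSubgroup.zsmul_mem _ hg0X r
  -- the new frame `g ∘ Fin.succ`
  refine ⟨fun j ↦ g j.succ, fun j ↦ ?_, fun j ↦ hgτ j.succ, fun b' hb' j ↦ ?_, fun y hy hyeig ↦ ?_⟩
  · -- (1) kept classes survive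
    rw [← hS'eq, hS']
    refine AddSubgroup.mem_inf.mpr ⟨hgRel j.succ, AddSubgroup.mem_comap.mpr ?_⟩
    change loc (g j.succ) ∈ _
    rw [hkept0 j]
    exact AddSubgroup.zero_mem _
  · -- near-freeness: extend the relation by `b₀ = 0`
    have hrel : ∀ σ ∈ torsionFixing (W.baseChange K) ((2 ^ (M + 1) : ℕ) : ℤ),
        h1Eval (W.baseChange K) ((2 ^ M : ℕ) : ℤ) (∑ i, (Fin.cons 0 b' : Fin (t + 1) → ℤ) i • g i) σ = 0 := fun σ hσ ↦ by
      rw [Fin.sum_univ_succ, Fin.cons_zero, zero_zsmul, zero_add]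
      simp only [Fin.cons_succ]
      exact hb' σ hσ
    have h := hfree _ hrel j.succ
    rw [Fin.cons_succ] at h
    exact (pow_dvd_pow 2 (by omega)).trans h
  · -- (2)+(3) no medium classes
    have hyS : y ∈ 𝓛.selmerGroup := by rw [hS'eq]; exact hy
    have hyRel : y ∈ SelmerStructure.selmerGroup (Function.update 𝓛 (Sum.inr v : Place K) ⊤ :
        SelmerStructure ((W.baseChange K).torsionGaloisModule ((2 ^ M : ℕ) : ℤ))) := by
      rw [hS'] at hyS; exact (AddSubgroup.mem_inf.mp hyS).1
    have hyT : loc y ∈ 𝒯' (Sum.inr v) := by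
      rw [hS'] at hyS; exact AddSubgroup.mem_comap.mp (AddSubgroup.mem_inf.mp hyS).2
    have hinvj : Function.Injective (inv (Sum.inr v)) := (hperf v).1.1
    have hvc : v ∈ placesDividing K (e' * q) := RegularRefill.mem_placesDividing_of_mem_primeFactors hc hqmem v hv
    have hττ : τ * τ = 1 := by
      haveI : Algebra.IsQuadraticExtension ℚ K := ⟨hK.1⟩
      have hcard : Nat.card (K ≃ₐ[ℚ] K) = 2 := by rw [IsGalois.card_aut_eq_finrank, hK.1]
      haveI : Finite (K ≃ₐ[ℚ] K) := Nat.finite_of_card_ne_zero (by rw [hcard]; decide)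
      have h : τ ^ Nat.card (K ≃ₐ[ℚ] K) = 1 := pow_card_eq_one'
      rw [hcard, pow_two] at h
      exact h
    haveI : ∀ w : Place K, CompactSpace (absoluteGaloisGroup (Place.Completion w)) :=
      fun w ↦ absoluteGaloisGroup_compactSpace _
    -- THE CUT LAW (g14's sign lemma): `2^(a+1) (τ_* loc y + (-u) loc y) = 0`
    have hsign := RegularRefill.nsmul_add_smul_eq_zero_of_mem_lagrangian
      (X11b.Relaxation.invWeilPairing (W.baseChange K) (2 ^ M) ew hμ hadd₁ hadd₂ hgal inv (Sum.inr v))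
      (fun x' y' ↦ AdditiveKoly.LagrangianSwitchAtP.invWeilPairing_symm (W.baseChange K) (2 ^ M) ew hμ hadd₁ hadd₂ hgal
        halt inv (Sum.inr v) x' y')
      (RegularRefill.kummer_sup_transverse_eq_top_two W M hK hD ι hM (e' * q) hc hkol hkM 𝒯' h𝒯' v hvc)
      (fun x' hx' y' hy' ↦ RegularRefill.transverse_isotropic_two W M ew hμ hadd₁ hadd₂ hgal halt hnondeg inv hK hD ι hM (e' * q) hc
        hkol hkM 𝒯' h𝒯' hperf v hvc hx' hy')
      (conjActPlace W τ ((2 ^ M : ℕ) : ℤ) hfix) (fun x' ↦ conjActPlace_conjActPlace W τ ((2 ^ M : ℕ) : ℤ) hττ hfix hfix x')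
      (fun x' y' ↦ RegularRefill.invWeilPairing_conjActPlace W τ (2 ^ M) ew hμ hadd₁ hadd₂ hgal inv (hconj τ) hfix hτe' x' y')
      (fun f hf ↦ conjActPlace_mem_kummerSelmerStructure W τ ((2 ^ M : ℕ) : ℤ) hfix hf)
      (fun x' hx' ↦ JET.forall_conjActPlace_mem_of_eq_iInf_transverseSubgroup W hK ι τ ((2 ^ M : ℕ) : ℤ) (e' * q) 𝒯' h𝒯' v v
        hfix hvc x' hx')
      hs (RegularRefill.invWeilPairing_injective_of_symm W M ew hμ hadd₁ hadd₂ hgal halt hnondeg inv v hinvj) _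
      (RegularRefill.isotropic_map_localization_relaxed_selmerF W M ew hμ hadd₁ hadd₂ hgal halt hnondeg inv hK hD ι hM (e' * q) hc
        hkol hkM 𝒯' h𝒯' hperf hvan v hvc)
      (a + 1) hcutX (t := loc y) (AddSubgroup.mem_inf.mpr ⟨AddSubgroup.mem_map.mpr ⟨y, hyRel, rfl⟩, hyT⟩)
    have hlocy : (2 : ℤ) ^ (a + 2) • loc y = 0 := by
      rw [hloceig hyeig, ← two_zsmul, smul_smul, ← natCast_zsmul, smul_smul] at hsign
      -- `hsign : (↑(2^(a+1)) * (2 * -u)) • loc y = 0`; multiply by `-u`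
      have hss : (-u) * (-u) = 1 := by rcases hu with rfl | rfl <;> norm_num
      have h := congrArg (fun z ↦ (-u) • z) hsign
      rw [smul_smul, zsmul_zero, show (-u) * (((2 ^ (a + 1) : ℕ) : ℤ) * (2 * -u)) = (2 : ℤ) ^ (a + 2) * ((-u) * (-u)) by
        rw [Nat.cast_pow, Nat.cast_ofNat, pow_succ]; ring, hss, mul_one] at h
      exact h
    -- `w := 2^(a+2) y ∈ H_{𝓕(e)}`
    set w : galH1Torsion (W.baseChange K) ((2 ^ M : ℕ) : ℤ) := (2 : ℤ) ^ (a + 2) • y with hw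
    have hlocw : loc w = 0 := by
      have e1 : loc w = (2 : ℤ) ^ (a + 2) • loc y := map_zsmul _ _ _
      rw [e1, hlocy]
    have hwE : w ∈ modifiedSelmerGroup W K ι ((2 ^ M : ℕ) : ℤ) e' := by
      rw [← hSeq, hSKum]
      refine AddSubgroup.mem_inf.mpr ⟨AddSubgroup.zsmul_mem _ hyRel _, AddSubgroup.mem_comap.mpr ?_⟩
      change loc w ∈ _
      rw [hlocw]
      exact AddSubgroup.zero_mem _
    have hweig : conjAct W τ ((2 ^ M : ℕ) : ℤ) w = (-u) • w := by
      rw [hw, map_zsmul, hyeig, smul_smul, smul_smul, mul_comm]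
    obtain ⟨b, hb⟩ := hspan w hwE hweig
    -- localise the relation at `v`: `b 0 • loc g₀ = 0`
    have hD0 : loc (((2 : ℤ) ^ a) • w - ∑ i, b i • g i) = 0 :=
      localization_eq_zero_of_res_eq_zero W hK hKolq (hkM q hqmem) v hv hb
    have hb0 : b 0 • loc (g 0) = 0 := by
      have e1 : loc (((2 : ℤ) ^ a) • w - ∑ i, b i • g i) = (2 : ℤ) ^ a • loc w - ∑ i, b i • loc (g i) := by
        rw [map_sub, map_zsmul, map_sum]
        congr 1
        exact Finset.sum_congr rfl fun i _ ↦ map_zsmul _ _ _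
      rw [e1, hlocw, zsmul_zero, zero_sub, neg_eq_zero, Fin.sum_univ_succ] at hD0
      have hz : ∑ i : Fin t, b i.succ • loc (g i.succ) = 0 :=
        Finset.sum_eq_zero fun i _ ↦ by rw [hkept0 i, zsmul_zero]
      rwa [hz, add_zero] at hD0
    have hdvd : (2 : ℤ) ^ (M - (a + 1) + 1) ∣ b 0 := RegularRefill.two_pow_dvd_of_zsmul_eq_zero_of_ne_zero (h2Mloc _) hcut0' hb0
    -- `2^a b₀ g₀ = 0`
    have hkill0 : ((2 : ℤ) ^ a * b 0) • g 0 = 0 := by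
      obtain ⟨r, hr⟩ := hdvd
      rw [hr, ← mul_assoc, ← pow_add]
      have hMle : M ≤ a + (M - (a + 1) + 1) := by omega
      rw [show (2 : ℤ) ^ (a + (M - (a + 1) + 1)) * r = r * (2 : ℤ) ^ (a + (M - (a + 1) + 1) - M) * (2 : ℤ) ^ M by
        rw [mul_comm, mul_assoc, ← pow_add, Nat.sub_add_cancel hMle], mul_smul,
        show ((2 : ℤ) ^ M) = ((2 ^ M : ℕ) : ℤ) by rw [Nat.cast_pow, Nat.cast_ofNat], h2M, zsmul_zero]
    refine ⟨fun j ↦ (2 : ℤ) ^ a * b j.succ, fun σ hσ ↦ ?_⟩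
    have hsplit : ((2 : ℤ) ^ (3 * a + 2)) • y - ∑ j : Fin t, ((2 : ℤ) ^ a * b j.succ) • g j.succ =
        (2 : ℤ) ^ a • (((2 : ℤ) ^ a) • w - ∑ i, b i • g i) := by
      have h1 : ((2 : ℤ) ^ (3 * a + 2)) • y = (2 : ℤ) ^ (a + a) • w := by
        rw [hw, smul_smul, ← pow_add, show 3 * a + 2 = a + a + (a + 2) by ring]
      have h2 : ∑ j : Fin t, ((2 : ℤ) ^ a * b j.succ) • g j.succ = ∑ i, ((2 : ℤ) ^ a * b i) • g i := by
        rw [Fin.sum_univ_succ, hkill0, zero_add]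
      rw [h1, h2]
      exact zsmul_sub_sum_zsmul_eq a a w b g
    rw [hsplit, h1Eval_zsmul _ _ _ _ (hle hσ), hb σ hσ, zsmul_zero]

end Summit.BirchSwinnertonDyer.BirchSwinnertonDyer.Theorems.KolyvaginAtTwo.RegularWalk

end
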